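import Literature.NumberTheory.GelbartRogawski1991.LocalGaloisConjRankTwoInner
import Literature.RepresentationTheory.TwistedCoinvariants
import HarnessLib

/-!
# Rank two, representation level: `π_ξ(ū) = ξ((det u)⁻¹) · π_ξ(k u k⁻¹)` on the `ξ`-coinvariants under the centre

Topic `NumberTheory/GelbartRogawski1991`; namespace `Literature.RepresentationTheory.TwistedCoinv` (continuing ★ `TwistedCoinvariants`,
★ `LocalGaloisConjCoinvariants`, ★ `LocalCongrCoinvariants`).  KERNEL ONLY: theorems; no definition, no named fact, no instance, no notation,
no `sorry`.  Cell `hodgecm-mathlib` (D-0151), programme P5 (crux HLiu418 = stmt-HodgeConjecture-24832), piece **(C2)-rep** of the road card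
`F0/P5/A-p18/g23/ROAD-L4if-v3.A-p18g23.md` §6 (row dealt by A-p18 (g23) 2026-08-31T23:55Z; seat B-p04 (g32)): the REPRESENTATION-LEVEL reading of
★ (C2) `UnitaryGroup.localPiGalConj_eq_localCenter_mul_localCongr` («`ū = ((det u)⁻¹ · 1₂) · (k u k⁻¹)`», `k = (wJ)⁻¹` the `F`-rational similitude of
[MoeglinVignerasWaldspurger1987, Chap. 1 I.17]).

* §1 (generic) `rep_apply_centre`: for commuting `ρV : G → GL(S)` and its restriction `ρW = ρV ∘ ι` along `ι : H →* G` (the centre), the element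
  `ι h` acts on the `χ`-coinvariants `Coinv (ρV ∘ ι) χ` by the scalar `χ h` — ★ `rep_eq_smul_of_forall` at `z := ι h`, `c := 1`
  ([Liu2021, App. D §D.1 Step 3]: «the maximal quotient on which the centre acts by `χ`»).
* §2 (rank 2, `J = T ⊗ 1`, `T` symmetric invertible, centre `J₁`) **`rep_localPiGalConj_eq_smul_rep_localCongr`**: for every representation `ω` of
  `U(J)(F_v)` (factor form ★ `localPi`) commuting with its centre and every character `ξ` of `Z = U(J₁)(F_v)`, on `Coinv (ω ∘ localCenter) ξ`:
  **`π_ξ(ū) x = ξ(localUnitScalar (det u)⁻¹) • π_ξ(k u k⁻¹) x`** with the `k`, `hk`-data LITERALLY those of ★ (C2) — `rw [(C2), map_mul]` + §1.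
  This is step (M2) of the road at the theta-type level: `π(ū) = ξ((det u)⁻¹) π(k u k⁻¹)` for a representation on which the centre acts by `ξ`.
Nothing of the cited sources is asserted; HC_CM is proved only modulo the printed citations until rung 0 closes.

## References
* [MoeglinVignerasWaldspurger1987] C. Mœglin, M.-F. Vignéras, J.-L. Waldspurger, LNM 1291 (1987), Chap. 1 I.17; Chap. 2 II.2.
* [Liu2021] Y. Liu, *Fourier–Jacobi cycles and arithmetic relative trace formula*, Camb. J. Math. 9 (2021), App. D §D.1 Step 3 (l. 5221).
* [PlatonovRapinchuk1994] V. Platonov, A. Rapinchuk, *Algebraic Groups and Number Theory* (1994), §2.3.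
-/

set_option autoImplicit false

noncomputable section

open NumberField IsDedekindDomain Matrix

namespace Literature.RepresentationTheory.TwistedCoinv

/-! ## §1 The centre acts by `χ` on the `χ`-coinvariants -/

section Generic

variable {k : Type*} [CommRing k] {G H S : Type*} [Group G] [Group H] [AddCommGroup S] [Module k S]

/-- **The centre acts by `χ`**: for `ρW = ρV ∘ ι`, the element `ι h ∈ G` acts on `Coinv (ρV ∘ ι) χ` by the scalar `χ h`
(★ `rep_eq_smul_of_forall` with `z := ι h`, `w := h`, `c := 1`). [cite: Liu2021, App. D §D.1 Step 3 (l. 5221)]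
[cite: MoeglinVignerasWaldspurger1987, Chap. 2 II.2] -/
theorem rep_apply_centre (χ : H →* kˣ) (ρV : Representation k G S) (ι : H →* G)
    (hc : ∀ (g : G) (h : H), Commute (ρV g) ((ρV.comp ι) h)) (h : H) (x : Coinv (ρV.comp ι) χ) :
    rep χ ρV hc (ι h) x = ((χ h : kˣ) : k) • x := by
  have key := rep_eq_smul_of_forall χ ρV hc (z := ι h) (w := h) (c := (1 : k))
    (fun v => by rw [one_smul, MonoidHom.comp_apply]) x
  rwa [one_mul] at key

end Generic

/-! ## §2 Rank two: `π_ξ(ū) = ξ((det u)⁻¹) · π_ξ(k u k⁻¹)` -/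

section Local

open Literature.NumberTheory.Automorphic Literature.NumberTheory.Automorphic.UnitaryGroup

variable {F : Type} (E : Type) [Field F] [NumberField F] [Field E] [NumberField E] [Algebra F E]
  (c : E ≃ₐ[F] E) {T : Matrix (Fin 2) (Fin 2) F} (hT : T.IsSymm) {J : Matrix (Fin 2) (Fin 2) E} (hJ : J = T.map (algebraMap F E))
  {J₁ : Matrix (Fin 1) (Fin 1) E} (hJ₁ : J₁ 0 0 ≠ 0) (v : HeightOneSpectrum (𝓞 F)) {δ : E} (hcδ : c δ = -δ) (hδ : δ ≠ 0)
  {S : Type*} [AddCommGroup S] [Module ℂ S]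

include hT hcδ hδ in
/-- **(C2) at the representation level.**  For a representation `ω` of `U(J)(F_v)` (`J = T ⊗ 1`, `T ∈ Sym₂(F)` invertible) commuting with its centre
`Z = U(J₁)(F_v)` (★ `localCenter`) and a character `ξ` of `Z`: on the `ξ`-coinvariants,
`π_ξ(ū) x = ξ(localUnitScalar (det u)⁻¹) • π_ξ(k u k⁻¹) x`, where `k = (wJ)⁻¹ ⊗ 1` and its similitude data are LITERALLY those of ★
`localPiGalConj_eq_localCenter_mul_localCongr` — the centre factor `(det u)⁻¹ · 1₂` acts by `ξ` (§1).
[cite: MoeglinVignerasWaldspurger1987, Chap. 1 I.17; Chap. 2 II.2] [cite: PlatonovRapinchuk1994, §2.3] [cite: Liu2021, App. D §D.1 Step 3 (l. 5221)] -/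
theorem rep_localPiGalConj_eq_smul_rep_localCongr [Algebra.IsQuadraticExtension F E] (hTd : T.det ≠ 0)
    (ω : Representation ℂ (localPi E c 2 J v) S) (ξ : localPi E c 1 J₁ v →* ℂˣ)
    (hc : ∀ (g : localPi E c 2 J v) (u : localPi E c 1 J₁ v), Commute (ω g) ((ω.comp (localCenter E c 2 J J₁ hJ₁ v)) u))
    (u : localPi E c 2 J v) (x : Coinv (ω.comp (localCenter E c 2 J J₁ hJ₁ v)) ξ) :
    rep ξ ω hc (localPiGalConj E c 2 v hJ u) x =
      ((ξ (localUnitScalar E c J₁ v _ (inv_det_mul_conjLocal_inv_det E c hJ v hcδ hδ hTd u)) : ℂˣ) : ℂ) •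
        rep ξ ω hc
          (localCongr E c (Matrix.GeneralLinearGroup.map (algebraMap F E) (Matrix.GeneralLinearGroup.mkOfDetNeZero _ (det_w_mul_ne_zero hTd))⁻¹)
            (det_form_ne_zero E hJ hTd) (formCongr_inv_w_mul c hT hJ hTd) v u) x := by
  rw [localPiGalConj_eq_localCenter_mul_localCongr E c hT hJ hJ₁ v hcδ hδ hTd u, map_mul, Module.End.mul_apply,
    rep_apply_centre ξ ω (localCenter E c 2 J J₁ hJ₁ v) hc]

end Local

end Literature.RepresentationTheory.TwistedCoinv

end
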